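import Summits.Ventures.HodgeRepro2.T5ProductIsotypic
import Summits.Ventures.HodgeRepro2.T5IsotypicFixed
import Summits.Ventures.HodgeRepro2.T5IsotypicRestrict

/-!
# T5FlathAdmissibleAssembly — (A3) STEP 6 assembled: «M is admissible in Flath's sense»

Cell pub-hodge-repro2, seat p5, Tier 5 (route/T5-N4-p5.md, N4.3 v13 (A3) STEP 6, l. 147: «An
irreducible finite-dimensional representation ρ of K is ρ_∞ ⊗ ρ_f with ρ_f a continuous
finite-dimensional representation of the profinite K_f^{max}, trivial on an open normal subgroup K′_f;
so the ρ-isotypic part M(ρ) is contained in π₀^{K′_f}[ρ_∞], which is finite-dimensional by STEP 5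
[…].  Hence M is admissible in Flath's sense: item (a) HOLDS.»).  In module language, for
`K = K₁ × K₂` («K_∞ × K_f^{max}»), a representation `π` of `K` on `M` («the K-finite vectors of
π₀»), an irreducible finite-dimensional `ρ` of `K` («the K-type»), a simple `ℂ[K₁]`-submodule `S₁`
of `ρ|_{K₁}` («ρ_∞») and a set `K' ⊆ K₂` acting trivially on `ρ` («K′_f», row 12):

* `le_map_isotypicComponent_of_isIsotypicOfType` (Mathlib only): a semisimple `S`-isotypic
  submodule `N ≤ W` lies in the `S`-isotypic component of `W`;
* `fixedSubmodule π K'`: the `K'`-fixed vectors («π₀^{K′_f}») as a `ℂ[K₁]`-submodule of `M|_{K₁}`;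
* `copy_le_fixedSubmodule`: a copy of `ρ` inside `π` consists of `K'`-fixed vectors;
* `restrict_copy_isIsotypicOfType`: restricted to `K₁`, a copy of `ρ` is `S₁`-isotypic (row 22);
* **`mem_isotypicComponent_fixed_of_mem`**: «M(ρ) ⊆ π₀^{K′_f}[ρ_∞]»;
* **`finite_isotypicComponent_of_fixed`**: hence `M(ρ)` is finite-dimensional whenever
  `(M^{K'})[S₁]` is — the STEP 5 output of rows 80 / 82 — i.e. Flath's admissibility of `M` for the
  `K`-type `ρ`.

Imports rows 22 / 24 / 81.  Axioms: propext, Classical.choice, Quot.sound.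
README §8(d): uses an L-value-free non-vanishing device: NO.
-/

namespace Summit.Ventures.HodgeRepro2.T5FlathAdmissibleAssembly

open Summit.Ventures.HodgeRepro2.T5IsotypicRestrict
  (compRep ofComp toComp restrictSubmodule restrictEquiv mem_restrictSubmodule ofComp_smul
    ofComp_toComp toComp_ofComp ofComp_add ofComp_zero)

/-! ### A semisimple isotypic submodule lies in the isotypic component of any submodule containing
it -/

section Isotypic

variable {R : Type*} [Ring R] {M' : Type*} [AddCommGroup M'] [Module R M'] (S : Type*)
  [AddCommGroup S] [Module R S] [IsSimpleModule R S]

omit [IsSimpleModule R S] in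
/-- A semisimple `S`-isotypic submodule `N` of `M'` contained in `W` lies in the `S`-isotypic
component of `W` (embedded in `M'`): `N` is the sum of its simple submodules, each `≅ S` and
contained in `W`. -/
theorem le_map_isotypicComponent_of_isIsotypicOfType {N W : Submodule R M'}
    [IsSemisimpleModule R N] (hN : IsIsotypicOfType R N S) (hNW : N ≤ W) :
    N ≤ (isotypicComponent R W S).map W.subtype := by
  intro x hx
  have htop : (⟨x, hx⟩ : N) ∈ (⊤ : Submodule R N) := Submodule.mem_top
  rw [← IsSemisimpleModule.sSup_simples_eq_top R N, sSup_eq_iSup'] at htop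
  refine Submodule.iSup_induction
    (fun P : {m : Submodule R N | IsSimpleModule R m} => (P : Submodule R N))
    (motive := fun y : N => (y : M') ∈ (isotypicComponent R W S).map W.subtype) htop ?_ ?_ ?_
  · rintro ⟨P, hP⟩ y hy
    haveI : IsSimpleModule R P := hP
    haveI : IsSimpleModule R (P.map N.subtype) :=
      IsSimpleModule.congr (Submodule.equivMapOfInjective N.subtype N.subtype_injective P).symm
    have hQN : P.map N.subtype ≤ N := Submodule.map_subtype_le N P
    obtain ⟨e⟩ := isIsotypicOfType_submodule_iff.mp hN (P.map N.subtype) hQN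
    have hQW : P.map N.subtype ≤ W := hQN.trans hNW
    have e' : (P.map N.subtype).comap W.subtype ≃ₗ[R] S :=
      (Submodule.comapSubtypeEquivOfLe hQW).trans e
    have hle : (P.map N.subtype).comap W.subtype ≤ isotypicComponent R W S := le_sSup ⟨e'⟩
    have hmem : (y : M') ∈ P.map N.subtype := Submodule.mem_map_of_mem hy
    have hmem' : (y : M') ∈ ((P.map N.subtype).comap W.subtype).map W.subtype := by
      rw [Submodule.map_comap_subtype]
      exact ⟨hQW hmem, hmem⟩
    exact Submodule.map_mono hle hmem'
  · simp
  · intro y z hy hz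
    rw [Submodule.coe_add]
    exact Submodule.add_mem _ hy hz

end Isotypic

/-! ### The `K'`-fixed vectors as a `ℂ[K₁]`-submodule -/

section Fixed

variable {K₁ K₂ : Type*} [Monoid K₁] [Monoid K₂]
variable {M : Type*} [AddCommGroup M] [Module ℂ M] (π : Representation ℂ (K₁ × K₂) M)

/-- `single (1, k) 1` commutes with `mapDomainRingHom ℂ inl a` in `ℂ[K₁ × K₂]`: the factors
commute. -/
theorem single_inr_comm (k : K₂) (a : MonoidAlgebra ℂ K₁) :
    MonoidAlgebra.single ((1 : K₁), k) (1 : ℂ) * MonoidAlgebra.mapDomainRingHom ℂ (MonoidHom.inl K₁ K₂) a =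
      MonoidAlgebra.mapDomainRingHom ℂ (MonoidHom.inl K₁ K₂) a * MonoidAlgebra.single ((1 : K₁), k) (1 : ℂ) := by
  induction a using MonoidAlgebra.induction_linear with
  | zero => simp
  | add a b ha hb => rw [map_add, mul_add, add_mul, ha, hb]
  | single g c =>
    rw [MonoidAlgebra.mapDomainRingHom_apply, MonoidAlgebra.mapDomain_single,
      MonoidAlgebra.single_mul_single, MonoidAlgebra.single_mul_single, MonoidHom.inl_apply]
    congr 1
    · ext <;> simp
    · ring

/-- **The `K'`-fixed vectors of `π`** («π₀^{K′_f}»), as a `ℂ[K₁]`-submodule of the restriction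
`π|_{K₁}` (the `K₁`-action commutes with `K₂`). -/
def fixedSubmodule (K' : Set K₂) :
    Submodule (MonoidAlgebra ℂ K₁) (compRep (MonoidHom.inl K₁ K₂) π).asModule where
  carrier := {x | ∀ k ∈ K', (MonoidAlgebra.single ((1 : K₁), k) (1 : ℂ)) •
    ofComp (MonoidHom.inl K₁ K₂) π x = ofComp (MonoidHom.inl K₁ K₂) π x}
  add_mem' {x y} hx hy := by
    simp only [Set.mem_setOf_eq, ofComp_add, smul_add] at hx hy ⊢
    intro k hk
    rw [hx k hk, hy k hk]
  zero_mem' := by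
    intro k _
    simp
  smul_mem' a x hx := by
    simp only [Set.mem_setOf_eq] at hx ⊢
    intro k hk
    rw [ofComp_smul, smul_smul, single_inr_comm, ← smul_smul, hx k hk]

/-- Membership in `fixedSubmodule`. -/
theorem mem_fixedSubmodule (K' : Set K₂) (x : (compRep (MonoidHom.inl K₁ K₂) π).asModule) :
    x ∈ fixedSubmodule π K' ↔ ∀ k ∈ K', (MonoidAlgebra.single ((1 : K₁), k) (1 : ℂ)) •
      ofComp (MonoidHom.inl K₁ K₂) π x = ofComp (MonoidHom.inl K₁ K₂) π x :=
  Iff.rfl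

/-- `x` is `K'`-fixed in the sense of `fixedSubmodule` iff `π (1, k) x = x` for all `k ∈ K'`. -/
theorem mem_fixedSubmodule_iff (K' : Set K₂) (x : (compRep (MonoidHom.inl K₁ K₂) π).asModule) :
    x ∈ fixedSubmodule π K' ↔ ∀ k ∈ K', π (1, k) (ofComp (MonoidHom.inl K₁ K₂) π x) =
      ofComp (MonoidHom.inl K₁ K₂) π x := by
  rw [mem_fixedSubmodule]
  refine forall₂_congr fun k _ => ?_
  rw [Representation.single_smul, one_smul]
  rfl

end Fixed

/-! ### Copies of `ρ` inside `π`: `K'`-fixed and `K₁`-isotypic of type `S₁` -/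

section Copies

variable {K₁ K₂ : Type*} [Monoid K₁] [Monoid K₂]
variable {M : Type*} [AddCommGroup M] [Module ℂ M] (π : Representation ℂ (K₁ × K₂) M)
variable {V : Type*} [AddCommGroup V] [Module ℂ V] (ρ : Representation ℂ (K₁ × K₂) V)

/-- A copy `m ≃ ρ` inside `π` consists of `K'`-fixed vectors when `K'` acts trivially on `ρ`. -/
theorem copy_le_fixedSubmodule (K' : Set K₂) (hK' : ∀ k ∈ K', ρ (1, k) = LinearMap.id)
    (m : Submodule (MonoidAlgebra ℂ (K₁ × K₂)) π.asModule)
    (e : m ≃ₗ[MonoidAlgebra ℂ (K₁ × K₂)] ρ.asModule) :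
    restrictSubmodule (MonoidHom.inl K₁ K₂) π m ≤ fixedSubmodule π K' := by
  intro x hx
  rw [mem_restrictSubmodule] at hx
  rw [mem_fixedSubmodule]
  intro k hk
  -- transport along `e`: `single (1,k) 1 • e w = e w`
  have h : MonoidAlgebra.single ((1 : K₁), k) (1 : ℂ) • (⟨ofComp (MonoidHom.inl K₁ K₂) π x, hx⟩ : m) =
      ⟨ofComp (MonoidHom.inl K₁ K₂) π x, hx⟩ := by
    apply e.injective
    rw [map_smul, Representation.single_smul, one_smul, hK' k hk, LinearMap.id_apply]
    rfl
  have h' := congrArg (fun z : m => (z : π.asModule)) h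
  simpa only [Submodule.coe_smul] using h'

/-- Restricted to `K₁`, a copy `m ≃ ρ` of the `K₁`-isotypic `ρ` (row 22: `ρ` irreducible, `S₁` a
simple `ℂ[K₁]`-submodule of `ρ|_{K₁}`) is `S₁`-isotypic. -/
theorem restrict_copy_isIsotypicOfType [ρ.IsIrreducible]
    (S₁ : Submodule (MonoidAlgebra ℂ K₁) (compRep (MonoidHom.inl K₁ K₂) ρ).asModule)
    [IsSimpleModule (MonoidAlgebra ℂ K₁) S₁]
    (m : Submodule (MonoidAlgebra ℂ (K₁ × K₂)) π.asModule)
    (e : m ≃ₗ[MonoidAlgebra ℂ (K₁ × K₂)] ρ.asModule) :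
    IsIsotypicOfType (MonoidAlgebra ℂ K₁) (restrictSubmodule (MonoidHom.inl K₁ K₂) π m) S₁ := by
  have htop : isotypicComponent (MonoidAlgebra ℂ K₁) (compRep (MonoidHom.inl K₁ K₂) ρ).asModule S₁ = ⊤ :=
    T5ProductIsotypic.isotypicComponent_eq_top ρ S₁
  have hiso : IsIsotypicOfType (MonoidAlgebra ℂ K₁) (compRep (MonoidHom.inl K₁ K₂) ρ).asModule S₁ :=
    IsIsotypicOfType.of_isotypicComponent_eq_top htop
  exact (LinearEquiv.isIsotypicOfType_iff (restrictEquiv (MonoidHom.inl K₁ K₂) π ρ m e)).mpr hiso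

/-- Restricted to `K₁`, a copy of `ρ` is semisimple (`ρ|_{K₁}` is its own `S₁`-isotypic component,
which is semisimple). -/
theorem restrict_copy_isSemisimpleModule [ρ.IsIrreducible]
    (S₁ : Submodule (MonoidAlgebra ℂ K₁) (compRep (MonoidHom.inl K₁ K₂) ρ).asModule)
    [IsSimpleModule (MonoidAlgebra ℂ K₁) S₁]
    (m : Submodule (MonoidAlgebra ℂ (K₁ × K₂)) π.asModule)
    (e : m ≃ₗ[MonoidAlgebra ℂ (K₁ × K₂)] ρ.asModule) :
    IsSemisimpleModule (MonoidAlgebra ℂ K₁) (restrictSubmodule (MonoidHom.inl K₁ K₂) π m) := by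
  have htop : isotypicComponent (MonoidAlgebra ℂ K₁) (compRep (MonoidHom.inl K₁ K₂) ρ).asModule S₁ = ⊤ :=
    T5ProductIsotypic.isotypicComponent_eq_top ρ S₁
  haveI : IsSemisimpleModule (MonoidAlgebra ℂ K₁) (compRep (MonoidHom.inl K₁ K₂) ρ).asModule := by
    apply IsSemisimpleModule.of_sSup_simples_eq_top
    apply top_le_iff.mp
    rw [← htop, isotypicComponent]
    apply sSup_le_sSup
    rintro m ⟨e⟩
    exact IsSimpleModule.congr e
  exact IsSemisimpleModule.congr (restrictEquiv (MonoidHom.inl K₁ K₂) π ρ m e)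

/-- **«M(ρ) ⊆ π₀^{K′_f}[ρ_∞]»** (STEP 6): every vector of the `ρ`-isotypic component of `π` lies in
the `S₁`-isotypic component of the `K'`-fixed vectors. -/
theorem mem_isotypicComponent_fixed_of_mem [ρ.IsIrreducible]
    (S₁ : Submodule (MonoidAlgebra ℂ K₁) (compRep (MonoidHom.inl K₁ K₂) ρ).asModule)
    [IsSimpleModule (MonoidAlgebra ℂ K₁) S₁] (K' : Set K₂) (hK' : ∀ k ∈ K', ρ (1, k) = LinearMap.id)
    (x : π.asModule) (hx : x ∈ isotypicComponent (MonoidAlgebra ℂ (K₁ × K₂)) π.asModule ρ.asModule) :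
    toComp (MonoidHom.inl K₁ K₂) π x ∈
      (isotypicComponent (MonoidAlgebra ℂ K₁) (fixedSubmodule π K') S₁).map
        (fixedSubmodule π K').subtype := by
  rw [isotypicComponent, sSup_eq_iSup'] at hx
  refine Submodule.iSup_induction
    (fun m : {m : Submodule (MonoidAlgebra ℂ (K₁ × K₂)) π.asModule |
      Nonempty (m ≃ₗ[MonoidAlgebra ℂ (K₁ × K₂)] ρ.asModule)} =>
        (m : Submodule (MonoidAlgebra ℂ (K₁ × K₂)) π.asModule))
    (motive := fun y => toComp (MonoidHom.inl K₁ K₂) π y ∈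
      (isotypicComponent (MonoidAlgebra ℂ K₁) (fixedSubmodule π K') S₁).map
        (fixedSubmodule π K').subtype) hx ?_ ?_ ?_
  · rintro ⟨m, ⟨e⟩⟩ y hy
    haveI := restrict_copy_isSemisimpleModule π ρ S₁ m e
    have hle := le_map_isotypicComponent_of_isIsotypicOfType S₁
      (restrict_copy_isIsotypicOfType π ρ S₁ m e) (copy_le_fixedSubmodule π ρ K' hK' m e)
    apply hle
    rw [mem_restrictSubmodule, ofComp_toComp]
    exact hy
  · simp
  · intro y z hy hz
    rw [T5IsotypicRestrict.toComp_add]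
    exact Submodule.add_mem _ hy hz

/-- The `ℂ`-linear inclusion `M(ρ) → (M^{K'})[S₁]`. -/
def isotypicToFixed [ρ.IsIrreducible]
    (S₁ : Submodule (MonoidAlgebra ℂ K₁) (compRep (MonoidHom.inl K₁ K₂) ρ).asModule)
    [IsSimpleModule (MonoidAlgebra ℂ K₁) S₁] (K' : Set K₂) (hK' : ∀ k ∈ K', ρ (1, k) = LinearMap.id) :
    isotypicComponent (MonoidAlgebra ℂ (K₁ × K₂)) π.asModule ρ.asModule →ₗ[ℂ]
      (isotypicComponent (MonoidAlgebra ℂ K₁) (fixedSubmodule π K') S₁).map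
        (fixedSubmodule π K').subtype where
  toFun x := ⟨toComp (MonoidHom.inl K₁ K₂) π x, mem_isotypicComponent_fixed_of_mem π ρ S₁ K' hK' x x.2⟩
  map_add' x y := by
    apply Subtype.ext
    rfl
  map_smul' c x := by
    apply Subtype.ext
    rfl

/-- The inclusion `M(ρ) → (M^{K'})[S₁]` is injective. -/
theorem isotypicToFixed_injective [ρ.IsIrreducible]
    (S₁ : Submodule (MonoidAlgebra ℂ K₁) (compRep (MonoidHom.inl K₁ K₂) ρ).asModule)
    [IsSimpleModule (MonoidAlgebra ℂ K₁) S₁] (K' : Set K₂) (hK' : ∀ k ∈ K', ρ (1, k) = LinearMap.id) :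
    Function.Injective (isotypicToFixed π ρ S₁ K' hK') := by
  intro x y hxy
  apply Subtype.ext
  have h := congrArg (fun z : (isotypicComponent (MonoidAlgebra ℂ K₁) (fixedSubmodule π K') S₁).map
    (fixedSubmodule π K').subtype => ofComp (MonoidHom.inl K₁ K₂) π
      (z : (compRep (MonoidHom.inl K₁ K₂) π).asModule)) hxy
  simpa only [isotypicToFixed, LinearMap.coe_mk, AddHom.coe_mk, ofComp_toComp] using h

/-- **STEP 6, «M is admissible in Flath's sense»**: if the `S₁`-isotypic part of the `K'`-fixed
vectors is finite-dimensional (rows 80 / 82: «π₀^{K′_f}[ρ_∞] is finite-dimensional by STEP 5»),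
then the `ρ`-isotypic component `M(ρ)` of `π` is finite-dimensional — for every irreducible
finite-dimensional `ρ = ρ_∞ ⊗ ρ_f` of `K₁ × K₂` with `ρ_f` trivial on `K'`. -/
theorem finite_isotypicComponent_of_fixed [ρ.IsIrreducible]
    (S₁ : Submodule (MonoidAlgebra ℂ K₁) (compRep (MonoidHom.inl K₁ K₂) ρ).asModule)
    [IsSimpleModule (MonoidAlgebra ℂ K₁) S₁] (K' : Set K₂) (hK' : ∀ k ∈ K', ρ (1, k) = LinearMap.id)
    [Module.Finite ℂ (isotypicComponent (MonoidAlgebra ℂ K₁) (fixedSubmodule π K') S₁)] :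
    Module.Finite ℂ (isotypicComponent (MonoidAlgebra ℂ (K₁ × K₂)) π.asModule ρ.asModule) := by
  haveI : Module.Finite ℂ ((isotypicComponent (MonoidAlgebra ℂ K₁) (fixedSubmodule π K') S₁).map
      (fixedSubmodule π K').subtype) :=
    Module.Finite.equiv ((Submodule.equivMapOfInjective (fixedSubmodule π K').subtype
      (fixedSubmodule π K').subtype_injective _).restrictScalars ℂ)
  exact Module.Finite.of_injective (isotypicToFixed π ρ S₁ K' hK')
    (isotypicToFixed_injective π ρ S₁ K' hK')

end Copies

end Summit.Ventures.HodgeRepro2.T5FlathAdmissibleAssembly
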